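import Summits.BirchSwinnertonDyer.Rank1Residual.X12.O11.HeegnerIndexManinDescent
import Summits.BirchSwinnertonDyer.Rank1Residual.X12.O11.RouteUHeegnerIndex
import Summits.BirchSwinnertonDyer.Rank1Residual.X12.O11.RouteUHeegnerIndexLevelZero
import HarnessLib

/-!
# O11 at an additive Eisenstein prime, ROUTE U — T-U5: THEOREM U typed BY NAME
# (`BSD(E,p)` from Kriz–Li Thm. 1.20 ∧ Rem. 3.10 + Gross–Zagier–Kolyvagin + the descent inputs)

HONEST FRAMING (cell `bsd-cm`, run/shared/lean/pub/bsd-cm/, verbatim): the programme isolates, for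
CM elliptic curves over `ℚ` of analytic rank `≤ 1`, classes on which the FULL BSD formula is
reduced — strictly by PUBLISHED theorems entering as named-fact binders — to ONE local problem at
ONE prime, and then TYPES that residual problem. Seat `bsd-cm-ram` (generation 3; statement typed by
the planner, TARGET.md §2 T-U5, sketch `HOME/lean/X12/O11/RouteUTheoremUTU5.sketch.lean`).
THEOREMS ONLY (no definition, no named fact; nothing asserted about any curve; no label moves).

## What is here (ROUTE U of `HOME/bsd-cm-ram/ROUTE-U.md`; TARGET §2 kernel decomposition T-U0–T-U5)

* `RouteU.bsdp_of_thm120_of_rem310` — **THEOREM U typed, prime-generic**: `BSD(W,p)` for a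
  globally minimal `W/ℚ` of analytic rank `1` and an odd prime `p` of ADDITIVE reduction
  (`|Ẽ^{ns}(𝔽_p)| = p`) which is EISENSTEIN for `W` in the trace form of Kriz–Li Thm. 1.20
  (`a_ℓ ≡ ψ(ℓ) + ψ⁻¹ω(ℓ)`), composed BY NAME from
  T-U0 (`O11.bsdp_of_heegnerIndexVal_eq_maninVal`, file `HeegnerIndexManinDescent.lean`: Gross–Zagier
  WITH the parametrisation constant, Kolyvagin, GZK, modularity, the twist's rank-`0` `p`-part,
  `p ∤ ∏c_ℓ`, `p ∤ #Ш(E)`, `p ∤ #Ш(E^{d_K})`), T-U2 (`RouteU.heegnerIndexVal_eq_maninVal_of_rem310`,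
  file `RouteUHeegnerIndex.lean`: `ord_p[E(K):ℤP] = ord_p c` from the unit logarithm and the
  level-`0` generator), T-U1 = the named fact `KrizLi2019.thm120_padicLogHeegner_unit_of_bernoulli`
  (Kriz–Li 2019 Thm. 1.20: `B_{1,ψ₀⁻¹ε_K}·B_{1,ψ₀ω⁻¹} ≢ 0 ⇒ (|Ẽ^{ns}|/p)·log_{ω_E}P ≢ 0 (mod p)`)
  and the named fact `KrizLi2019.rem310_padicLogHeegner_integral` (Rem. 3.10, `p`-integrality).
  EVERY binder is displayed; relative to the planner's sketch ONE binder is REMOVED: `c ≠ 0` is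
  not assumed but DERIVED from the unit statement (`KrizLi2019.padicLogOrd_eq_of_norm_eq_one`).
* The 𝒞₇ corollary (the same inputs at `p = 7` + `ClassCSeven W` ⇒ Miller's `BSD(E,p)` at EVERY
  prime, via `ClassCSeven.forall_bsdp_iff_bsdp_seven`) is filed in the sequel
  `RouteUSevenFullBSD.lean` together with the (U-D) ∧ (U-A) corollaries (that module imports
  `CMSevenAwayFromSeven`, kept out of this file's import closure).

For `W` = the minimal model of `E_D = 49a1^{(D)}` (`D < −4` odd fundamental, `7 ∤ D`), `p = 7`,
`K = K'' = ℚ(√d'')` auxiliary with `7` and every prime of `D` split, `ψ` with `E_D[7]^{ss} ≅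
𝔽₇(ψ) ⊕ 𝔽₇(ψ⁻¹ω)`: the Bernoulli binder `hB` is (H-B) `7 ∤ β₁(D)β₂(D,d'')`, and the descent binders
(`htamW`, `hSW`, `hSd`, the level-`0` generator `g`/`hg0`, no `7`-torsion) are the memo's Prop. D /
Thm. U (i)–(iii) (`#Sel⁷(E_D) = 7`, `Ш(E_D^{(Dd'')})[7] = 0`, `n(D) = 0`) — PAPER (T-U3), per member
two-engine numerics (103 instances `|D| ≤ 3000`, memo §2/A7); nothing booked here.
What this file does NOT do: prove any named fact; discharge the per-curve binders; touch the O11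
CONSTRUCTION (★_an) (`RamifiedStrictDescent.lean`) — Route U is the UNIT CASE only.

References: [KrizLi2019] Thm. 1.20 (pp. 7–8) = Thm. 7.1, Rem. 1.17, Rem. 1.21, Rem. 3.10, §10.3;
[GrossZagier1986] V.§2; [JetchevSkinnerWan2017] §7.4.1; [Miller2011LMS] Def. 1.1.
-/

noncomputable section

open scoped Classical
open NumberField WeierstrassCurve IsDedekindDomain Literature.NumberTheory.EllipticCurves
open Literature.NumberTheory.EllipticCurves.ModularForms Literature.NumberTheory.EllipticCurves.Rank1Residual
open Literature.NumberTheory.QuadraticFields Summit.BirchSwinnertonDyer.Rank1Residual.X11b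

namespace Summit.BirchSwinnertonDyer.Rank1Residual.X12.O11.RouteU

/-- **THEOREM U typed (T-U5; prime-generic): `BSD(W, p)` at an additive Eisenstein prime from
Kriz–Li Thm. 1.20 ∧ Rem. 3.10, Gross–Zagier–Kolyvagin and the descent inputs.** Composition BY
NAME of T-U0 (`O11.bsdp_of_heegnerIndexVal_eq_maninVal`) and T-U2
(`heegnerIndexVal_eq_maninVal_of_rem310`) with the named facts `hKL` (Thm. 1.20) and `hRem`
(Rem. 3.10); every binder displayed — T-U0's Heegner/GZ/Kolyvagin/twist inputs, Thm. 1.20's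
character data `(f, ψ, ω, ε_K)` with the trace form `hss`, (1)–(3) and the Bernoulli non-vanishing
`hB`, the additive count `hns`, and T-U2's rank-one level-`0` coordinate data; `c ≠ 0` is derived
(the unit statement forces it). At `p = 7`, `W` = minimal model of `49a1^{(D)}`, `K = K''`: ROUTE U
(memo Thm. U). [cite: KrizLi2019, Thm. 1.20 (pp. 7–8), Rem. 1.21 (p. 8), Rem. 3.10 (p. 26), §10.3]
[cite: GrossZagier1986, V.§2 (pp. 310–312)] [cite: Miller2011LMS, Def. 1.1] -/
theorem bsdp_of_thm120_of_rem310
    (hKL : KrizLi2019.thm120_padicLogHeegner_unit_of_bernoulli)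
    (hRem : KrizLi2019.rem310_padicLogHeegner_integral)
    (W : WeierstrassCurve ℚ) [W.IsElliptic] [W.IsGloballyMinimal] (p : ℕ) [Fact p.Prime]
    [NeZero (W.conductorNorm ℤ)] (K : Type) [Field K] [NumberField K]
    [NeZero (NumberField.discr K).natAbs]
    (D : ModularParametrizationData W (W.conductorNorm ℤ))
    (H : HeegnerDatum (W.conductorNorm ℤ) (NumberField.discr K)) (ι : K →+* ℂ) (ιp : K →+* ℚ_[p])
    (P : (W.baseChange K).toAffine.Point)
    -- T-U0's displayed inputs (`O11.bsdp_of_heegnerIndexVal_eq_maninVal`), minus `c ≠ 0`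
    (hGZ : gross_zagier (W.conductorNorm ℤ) W K) (hKo : kolyvagin (W.conductorNorm ℤ) W K)
    (hGZK : rank_eq_analyticRank_of_analyticRank_le_one) (hmod : hasEntireLFunction_rat)
    (hK : IsImaginaryQuadratic K) (hHN : SatisfiesHeegnerHypothesis (W.conductorNorm ℤ) K)
    (hP : WeierstrassCurve.Affine.Point.map ι.toRatAlgHom P = heegnerPointComplex D H)
    (hp2 : p ≠ 2) (hμ : ¬ p ∣ Units.torsionOrder K)
    (hr : W.analyticRank = 1)
    (hLt : (W.quadraticTwist (NumberField.discr K : ℚ)).entireLFunction 1 ≠ 0)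
    (Wd : WeierstrassCurve ℚ) [Wd.IsElliptic] [Wd.IsGloballyMinimal] (Cd : VariableChange ℚ)
    (hWd : Cd • W.quadraticTwist (NumberField.discr K : ℚ) = Wd)
    (htw : ∃ q : ℚ, Wd.entireLFunction 1 / (Wd.realPeriodRat : ℂ) = (q : ℂ) ∧
      padicValRat p q = (padicValNat p Wd.shaOrder : ℤ) + padicValNat p Wd.tamagawaProduct -
        2 * padicValNat p Wd.torsionOrder)
    (htam : padicValNat p Wd.tamagawaProduct = padicValNat p W.tamagawaProduct)
    (hu : padicValRat p (Cd.u : ℚ) = 0)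
    (htamW : ¬ p ∣ W.tamagawaProduct)
    (hSW : ∀ [Finite W.sha], ¬ p ∣ W.shaOrder) (hSd : ∀ [Finite Wd.sha], ¬ p ∣ Wd.shaOrder)
    -- Thm. 1.20's displayed inputs (`KrizLi2019.thm120_padicLogHeegner_unit_of_bernoulli`)
    (f : ℕ) [NeZero f] (ψ : DirichletCharacter ℚ_[p] f) (ω : DirichletCharacter ℚ_[p] p)
    (hψ : ψ.IsPrimitive) (hω : KrizLi2019.IsTeichmullerCharacter ω)
    (hss : ∀ ℓ : ℕ, ℓ.Prime → ¬ (ℓ ∣ p * W.conductorNorm ℤ) →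
      ‖((W.LFunction ℓ : ℤ) : ℚ_[p]) - (ψ (ℓ : ZMod f) + ψ⁻¹ (ℓ : ZMod f) * ω (ℓ : ZMod p))‖ < 1)
    (h1a : ψ (p : ZMod f) ≠ 1) (h1b : KrizLi2019.primVal (KrizLi2019.invMulOmega ψ ω) p ≠ 1)
    (h2 : ∀ ℓ : ℕ, (hℓ : ℓ.Prime) →
      ¬ (haveI := Fact.mk hℓ; W.HasSplitMultiplicativeReductionAtPrime ℓ))
    (h3 : ∀ ℓ : ℕ, (hℓ : ℓ.Prime) → ℓ ≠ p →
      (haveI := Fact.mk hℓ;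
        ¬ W.HasGoodReductionAtPrime ℓ ∧ ¬ W.HasMultiplicativeReductionAtPrime ℓ) →
      ψ (ℓ : ZMod f) ≠ 1 ∧ KrizLi2019.primVal (KrizLi2019.invMulOmega ψ ω) ℓ ≠ 1)
    (hsplit : ((Ideal.span {(p : ℤ)}).primesOver (𝓞 K)).ncard = 2)
    (εK : DirichletCharacter ℚ_[p] (NumberField.discr K).natAbs)
    (hεK : KrizLi2019.IsKroneckerCharacterOf K εK)
    (hB : ¬ (‖KrizLi2019.bernoulliOnePrim (KrizLi2019.bernoulliCharOne ψ εK) *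
        KrizLi2019.bernoulliOnePrim (KrizLi2019.bernoulliCharTwo ψ εK ω)‖ ≤ (p : ℝ)⁻¹))
    -- T-U2's displayed inputs (`heegnerIndexVal_eq_maninVal_of_rem310`)
    (hns : KrizLi2019.nsPointCount W p = p)
    [Finite (AddCommGroup.torsion (W.baseChange K).toAffine.Point)]
    (crd : (W.baseChange K).toAffine.Point →+ ℤ) (g : (W.baseChange K).toAffine.Point)
    (hg : crd g = 1) (hker : ∀ x, crd x = 0 → IsOfFinAddOrder x)
    (hiv : ∀ x : (W.baseChange K).toAffine.Point, p • x = 0 → x = 0)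
    (hg0 : ‖Castella2018.padicLogOmega W p ιp g‖ = 1) :
    BSDp W p :=
  -- the conclusion of Thm. 1.20 at this Heegner point, and the unit statement (with Rem. 3.10)
  have hne := hKL p hp2 W f ψ ω hψ hω hss h1a h1b h2 h3 D K hK hHN hsplit εK hεK H ι ιp P hP hB
  have hc0 : D.c ≠ 0 :=
    (KrizLi2019.padicLogOrd_eq_of_norm_eq_one
      (KrizLi2019.norm_eq_one_of_rem310 hRem D hK hHN hsplit H ι ιp hP hne)).2.1
  bsdp_of_heegnerIndexVal_eq_maninVal W p (W.conductorNorm ℤ) K D H ι P hGZ hKo hGZK hmod hK hHN hP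
    hp2 hc0 hμ hr hLt Wd Cd hWd htw htam hu
    (heegnerIndexVal_eq_maninVal_of_rem310 hRem W p D hK hHN hsplit H ι ιp P hP hne
      hns crd g hg hker hiv hg0)
    htamW hSW hSd

/-- **THEOREM U typed, Manin-unit form (T-U5′ = T-U5 with T-U2′): `BSD(W, p)` at an additive
Eisenstein prime `p ≥ 5` WITHOUT the level-zero generator hypothesis `hg0`**, replaced by
`Addv W p`, `5 ≤ p` and `p ∤ c` (the Manin constant of the parametrisation): at an additive prime
`log_{ω_E}` is `p`-integral on `E(K)` (`RouteU.norm_padicLogOmega_le_one_of_addv`), so the unit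
statement of Thm. 1.20 ∧ Rem. 3.10 forces `ord_p [E(K):ℤP] = 0 = ord_p c`
(`heegnerIndexVal_eq_maninVal_of_rem310_of_not_dvd`). All other binders as in
`bsdp_of_thm120_of_rem310`. For the optimal curves of conductor `≤ 130000` the Manin constant is a
`p`-unit for `p` odd in print (Agashe–Ribet–Stein 2006, Thm. 2.6).
[cite: KrizLi2019, Thm. 1.20 (pp. 7–8), Rem. 3.10 (p. 26), §10.3]
[cite: GrossZagier1986, V.§2 (pp. 310–312)] [cite: Miller2011LMS, Def. 1.1] -/
theorem bsdp_of_thm120_of_rem310_of_not_dvd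
    (hKL : KrizLi2019.thm120_padicLogHeegner_unit_of_bernoulli)
    (hRem : KrizLi2019.rem310_padicLogHeegner_integral)
    (W : WeierstrassCurve ℚ) [W.IsElliptic] [W.IsGloballyMinimal] (p : ℕ) [Fact p.Prime]
    [NeZero (W.conductorNorm ℤ)] (K : Type) [Field K] [NumberField K]
    [NeZero (NumberField.discr K).natAbs]
    (D : ModularParametrizationData W (W.conductorNorm ℤ))
    (H : HeegnerDatum (W.conductorNorm ℤ) (NumberField.discr K)) (ι : K →+* ℂ) (ιp : K →+* ℚ_[p])
    (P : (W.baseChange K).toAffine.Point)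
    -- T-U0's displayed inputs (`O11.bsdp_of_heegnerIndexVal_eq_maninVal`), minus `c ≠ 0`
    (hGZ : gross_zagier (W.conductorNorm ℤ) W K) (hKo : kolyvagin (W.conductorNorm ℤ) W K)
    (hGZK : rank_eq_analyticRank_of_analyticRank_le_one) (hmod : hasEntireLFunction_rat)
    (hK : IsImaginaryQuadratic K) (hHN : SatisfiesHeegnerHypothesis (W.conductorNorm ℤ) K)
    (hP : WeierstrassCurve.Affine.Point.map ι.toRatAlgHom P = heegnerPointComplex D H)
    (hp2 : p ≠ 2) (hμ : ¬ p ∣ Units.torsionOrder K)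
    (hr : W.analyticRank = 1)
    (hLt : (W.quadraticTwist (NumberField.discr K : ℚ)).entireLFunction 1 ≠ 0)
    (Wd : WeierstrassCurve ℚ) [Wd.IsElliptic] [Wd.IsGloballyMinimal] (Cd : VariableChange ℚ)
    (hWd : Cd • W.quadraticTwist (NumberField.discr K : ℚ) = Wd)
    (htw : ∃ q : ℚ, Wd.entireLFunction 1 / (Wd.realPeriodRat : ℂ) = (q : ℂ) ∧
      padicValRat p q = (padicValNat p Wd.shaOrder : ℤ) + padicValNat p Wd.tamagawaProduct -
        2 * padicValNat p Wd.torsionOrder)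
    (htam : padicValNat p Wd.tamagawaProduct = padicValNat p W.tamagawaProduct)
    (hu : padicValRat p (Cd.u : ℚ) = 0)
    (htamW : ¬ p ∣ W.tamagawaProduct)
    (hSW : ∀ [Finite W.sha], ¬ p ∣ W.shaOrder) (hSd : ∀ [Finite Wd.sha], ¬ p ∣ Wd.shaOrder)
    -- Thm. 1.20's displayed inputs (`KrizLi2019.thm120_padicLogHeegner_unit_of_bernoulli`)
    (f : ℕ) [NeZero f] (ψ : DirichletCharacter ℚ_[p] f) (ω : DirichletCharacter ℚ_[p] p)
    (hψ : ψ.IsPrimitive) (hω : KrizLi2019.IsTeichmullerCharacter ω)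
    (hss : ∀ ℓ : ℕ, ℓ.Prime → ¬ (ℓ ∣ p * W.conductorNorm ℤ) →
      ‖((W.LFunction ℓ : ℤ) : ℚ_[p]) - (ψ (ℓ : ZMod f) + ψ⁻¹ (ℓ : ZMod f) * ω (ℓ : ZMod p))‖ < 1)
    (h1a : ψ (p : ZMod f) ≠ 1) (h1b : KrizLi2019.primVal (KrizLi2019.invMulOmega ψ ω) p ≠ 1)
    (h2 : ∀ ℓ : ℕ, (hℓ : ℓ.Prime) →
      ¬ (haveI := Fact.mk hℓ; W.HasSplitMultiplicativeReductionAtPrime ℓ))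
    (h3 : ∀ ℓ : ℕ, (hℓ : ℓ.Prime) → ℓ ≠ p →
      (haveI := Fact.mk hℓ;
        ¬ W.HasGoodReductionAtPrime ℓ ∧ ¬ W.HasMultiplicativeReductionAtPrime ℓ) →
      ψ (ℓ : ZMod f) ≠ 1 ∧ KrizLi2019.primVal (KrizLi2019.invMulOmega ψ ω) ℓ ≠ 1)
    (hsplit : ((Ideal.span {(p : ℤ)}).primesOver (𝓞 K)).ncard = 2)
    (εK : DirichletCharacter ℚ_[p] (NumberField.discr K).natAbs)
    (hεK : KrizLi2019.IsKroneckerCharacterOf K εK)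
    (hB : ¬ (‖KrizLi2019.bernoulliOnePrim (KrizLi2019.bernoulliCharOne ψ εK) *
        KrizLi2019.bernoulliOnePrim (KrizLi2019.bernoulliCharTwo ψ εK ω)‖ ≤ (p : ℝ)⁻¹))
    -- T-U2's displayed inputs (`heegnerIndexVal_eq_maninVal_of_rem310`)
    (hns : KrizLi2019.nsPointCount W p = p)
    [Finite (AddCommGroup.torsion (W.baseChange K).toAffine.Point)]
    (crd : (W.baseChange K).toAffine.Point →+ ℤ) (g : (W.baseChange K).toAffine.Point)
    (hg : crd g = 1) (hker : ∀ x, crd x = 0 → IsOfFinAddOrder x)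
    (hiv : ∀ x : (W.baseChange K).toAffine.Point, p • x = 0 → x = 0)
    -- T-U2′'s inputs replacing the level-zero generator `hg0` (`RouteUHeegnerIndexLevelZero`)
    (hadd : Addv W p) (hp5 : 5 ≤ p) (hc : ¬ (p : ℤ) ∣ D.c) :
    BSDp W p :=
  -- the conclusion of Thm. 1.20 at this Heegner point, and the unit statement (with Rem. 3.10)
  have hne := hKL p hp2 W f ψ ω hψ hω hss h1a h1b h2 h3 D K hK hHN hsplit εK hεK H ι ιp P hP hB
  have hc0 : D.c ≠ 0 :=
    (KrizLi2019.padicLogOrd_eq_of_norm_eq_one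
      (KrizLi2019.norm_eq_one_of_rem310 hRem D hK hHN hsplit H ι ιp hP hne)).2.1
  bsdp_of_heegnerIndexVal_eq_maninVal W p (W.conductorNorm ℤ) K D H ι P hGZ hKo hGZK hmod hK hHN hP
    hp2 hc0 hμ hr hLt Wd Cd hWd htw htam hu
    (heegnerIndexVal_eq_maninVal_of_rem310_of_not_dvd hRem W p D hK hHN hsplit H ι ιp P hP hne
      hns hadd hp5 crd g hg hker hiv hc)
    htamW hSW hSd

end Summit.BirchSwinnertonDyer.Rank1Residual.X12.O11.RouteU

end
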